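import Summits.QuantumFields.YangMills.Theorems.UnitScaleTiltProp7SymAvgTwOfRegPr
import Summits.QuantumFields.YangMills.Theorems.UnitScaleTiltProp7QprimeCombL2Defs
import Literature.MathematicalPhysics.QuantumFieldTheory.Balaban1983to89.B8Eq131Derivation
import Literature.MathematicalPhysics.QuantumFieldTheory.Balaban1983to89.B8Eq178Averages
import HarnessLib

/-!
# Route `UnitScaleTilt`, crux K1 «MinimiserStabilityRegPr» (stmt-QuantumFields-19200) — LANE II «DIVERGENCE RECOVERY AT CURVED `W`» (★★OWNER RULING №23), brick (B3)
# «INTERTWINING»: **THE EXACT INTERTWINING `Q(W)·D_W = D̄_{Ū}·Q′_k(W)` FOR THE TWISTED AVERAGING OF RECORD** — [Balaban1985BackgroundPropagators] (3.114)–(3.115) for the route's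
# `QTw` (the linear part of print's double-bar average (89)–(92) with the symmetric inner average), for EVERY gauge parameter `λ` (not only the axial slice), `C3 = 0`

Cell `ym3-torus` ∕ width seat `ym-ust-19200-w1` (gen 15).  THEOREMS ONLY (0 `def`, 0 `sorry`); `--supports stmt-QuantumFields-19200 --as helper`, count-neutral.
YM₃ on T³ is a ladder rung (R3), not d = 4, not infinite volume, not the Clay problem; nothing here claims the stub, the crux, `hN06`, (V3) or the mass gap.

THE PRINT.  [Balaban1985BackgroundPropagators] p. 418: «\overline{R_yU′} = u(y)(\overline{Ru})⁻¹(y) … hence Ū′_c = (R̄u)(c₋)R̄_c(R̄u)⁻¹(c₊) … (QD^{L⁻¹}λ)(c) = R̄_c(Q′λ)(c₊) − (Q′λ)(c₋) = (D_ŪQ′λ)(c)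
(3.114) … Iterating this identity we obtain finally Q_jDλ = D̄ʲQ′_jλ (3.115)»; [Balaban1985Averaging] (84) p. 30 «(\overline{R₀u}ʲ)(x_j) = u(x_j)\overline{R_{0,x_j}U₁}^{(j)}», (87) p. 31,
(89)–(92) p. 31; [Balaban1985RegularSpaces] (1.29) p. 81.

WHY (LANE II skeleton ★p1 g19 v1.3 §3 (B2+B3) `coarseCalculus_package`, rows (B3a)(B3b)).  The route's averaging of record is `Qkc = η • toL2B ∘ QTw ∘ toL2⁻¹` with
`QTw W := fderiv (logChartTw W) 0` (✓`Prop7SymAvgTwDefs`).  The tree has `QTw W = QSym W − D̄_{Ū}∘r` (✓`QTw_apply_eq_of_regPr`) and `QSym W (D_Wλ) = D̄_{Ū}(λ∘x̂)` (✓`QSym_gaugeDir_of_regPr`),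
`Ū = descendToGL W`; so `QTw W (D_Wλ) = D̄_{Ū}(λ∘x̂ − r(D_Wλ))`.  THIS FILE identifies the bracket: along the pure-gauge curve `W^{e^{tλ}}` the accumulated block frame of the perturbation is
`e^{tλ(x̂y)}·(R̄ᵏ_W e^{−tλ})(y)` ((84) at a pure-gauge perturbation — §1, no window), so `r(D_Wλ)(y) = λ(x̂y) − (Q′_k(W)λ)(y)` and **`QTw W (D_Wλ) = D̄_{Ū}(Q′_k(W)λ)`** EXACTLY (§2),
`Q′_k(W)` = print's comb site average = the route's `QprimeCombL2 W` read at the `k`-centres.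

WHAT IS PROVED (ns `…Theorems.Prop7TwistedIntertwining`):
* §1 (lit `ℤᵈ` letters) `tHol_one_pert`, ★★`wrec_pureGauge` (`wrec L U₀ (mgauge U₀ v 1) j y = v(Lʲ•y)·uavg L U₀ v⁻¹ j y` — lit ✓`B8Eq131Derivation.eq84_local` at the trivial perturbation),
  ★★`hasDerivAt_wrec_expGauge` (`d∕dt|₀ wrec L U₀ (mgauge U₀ e^{tλ} 1) j y = λ(Lʲ•y) − (Q′_jλ)(y)`, lit ✓`rbar_bgT_eq_uavg` ∘ ✓`hasDerivAt_Rbar`).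
* §2 (member) ★★★`QTw_gaugeDir_eq_coarseGaugeDir_Qprime` — at `RegPr F n K ε₀ W` inside the windows of ✓`QTw_apply_eq_of_regPr` VERBATIM, for EVERY `λ`:
  `QTw W (b ↦ λ b₋ − W_b λ b₊ W_b⁻¹) = (c ↦ Q′λ c₋ − Ū(c) Q′λ c₊ Ū(c)⁻¹)`, `Q′λ y := QprimeIter (zdBlocking 3 L) (bgT L W♯) (K−n) λ♯ (coordT3 y)`.
HONEST SCOPE.  Calculus over landed identities (chain rule along the gauge curve; no estimate); (B3a)∕(B3b) in the v1.3 currency and (B3c) are the sequel.  Rung R3, not Clay; YM gap NOT proved.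

References: T. Bałaban, CMP **99** (1985) 389–434 [Balaban1985BackgroundPropagators] ((3.14)–(3.19) p.393, (3.113)–(3.115) p.418); CMP **98** (1985) 17–51 [Balaban1985Averaging]
((55) p.27, (78)–(87) pp.30–31, (89)–(92) p.31); CMP **99** (1985) 75–102 [Balaban1985RegularSpaces] ((1.19) p.79, (1.29) p.81).
-/

set_option autoImplicit false

noncomputable section

open scoped Matrix.Norms.L2Operator Topology

namespace Summit.QuantumFields.YangMills.Theorems.Prop7TwistedIntertwining

open NormedSpace Filter
open Literature.MathematicalPhysics.QuantumFieldTheory.Balaban1983to89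
open B7Prop1Explicit (expUnit val_expUnit val_inv_expUnit hol)
open B7Prop2Explicit (avgIter)
open B7Eq78Linearization (Rbar QprimeIter zdBlocking hasDerivAt_Rbar zdBlocking_normalised Rbar_one QprimeIter_smul hasDerivAt_exp_smul_zero
  hasDerivAt_mlog_comp hasDerivAt_inverse_comp_one)
open B7Eq92Concrete (mgauge tHol tildIter)
open B7Eq99Concrete (wrec)
open B7Eq84Concrete (uavg)
open B7AvgGaugeCovariance (uLev uLev_apply)
open B8Eq119TwistedAxial (bgT)
open B8Eq131Derivation (eq84_local mgauge_inv_mgauge)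
open B8Eq178Averages (rbar_bgT_eq_uavg)
open Literature.MathematicalPhysics.QuantumFieldTheory.Balaban1983to89.T3ContinuumYM3Torus
open T3PrintedRegularMinimiser (RegPr)
open T3LevelShift (siteShift)
open T3PrintedRegularOrbits (sites_eq)
open T3SectALandauChart (bgUnits)
open B15DeterminingSets (embIter)
open B7Prop2Explicit (C0 c2')
open B10Eq27TorusAxialLog (pull gaugeActT transl pull_apply gaugeActT_apply pull_gaugeActT)
open B8Thm2SetupTorus (pullGauge pullGauge_apply)
open MatrixLog (mlog mlog_one)
open Summit.QuantumFields.YangMills.Theorems.Prop7SPrint (basePt)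
open Summit.QuantumFields.YangMills.Theorems.Prop7SymAvgGL (descendToGL)
open Summit.QuantumFields.YangMills.Theorems.Prop7SymAvgTw (frameTw logChartTw QTw coordT3 frameTw_def dbarTw_def logChartTw_apply QTw_def coordT3_apply)
open Summit.QuantumFields.YangMills.Theorems.Prop7SymAvgTwBridge (hasFDerivAt_logChartTw)
open Summit.QuantumFields.YangMills.Theorems.Prop7SymAvgRelDiffT3 (hasFDerivAt_rel_of_regPr)
open Summit.QuantumFields.YangMills.Theorems.Prop7SymAvgTwFrameDiff (hasFDerivAt_frameTw_of_regPr)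
open Summit.QuantumFields.YangMills.Theorems.Prop7QSymGaugeCovariance (descendToGL_gaugeActT hasDerivAt_mlog_conjCurve conjCurve_zero expUnit_chartCurve_eventually)
open Summit.QuantumFields.YangMills.Theorems.Prop7FlatHolonomy (transfUp_eq_embIter)
open Summit.QuantumFields.YangMills.Theorems.Prop7AxialReprPrint (embIter_eq_transl)

variable {d : ℕ}

/-! ## §1 The accumulated block frame of a PURE-GAUGE perturbation ((84)∕(87) with `U′ = 1`), and its derivative along `e^{tλ}` -/

section PureGauge

variable {𝔸 : Type*} [NormedRing 𝔸] [NormedAlgebra ℂ 𝔸] [CompleteSpace 𝔸]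

omit [NormedAlgebra ℂ 𝔸] [CompleteSpace 𝔸] in
/-- The twisted holonomy (58) of the TRIVIAL perturbation is `1`. [cite: Balaban1985Averaging, (58) p.27] -/
theorem tHol_one_pert (V₀ : B7Prop1Explicit.Site d → Fin d → 𝔸ˣ) (y : B7Prop1Explicit.Site d) (w : List (B7Prop1Explicit.Letter d)) :
    tHol V₀ (1 : B7Prop1Explicit.Site d → Fin d → 𝔸ˣ) y w = 1 := by
  rw [tHol, one_mul, mul_inv_cancel]

/-- The double-bar tower (91)–(92) of the TRIVIAL perturbation is `1` at every level. [cite: Balaban1985Averaging, (91)–(92) p.31] -/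
theorem tildIter_one_pert (L : ℕ) (U₀ : B7Prop1Explicit.Site d → Fin d → 𝔸ˣ) (n : ℕ) :
    tildIter L U₀ (1 : B7Prop1Explicit.Site d → Fin d → 𝔸ˣ) n = 1 := by
  funext z κ
  rw [tildIter, one_mul, mul_inv_cancel, Pi.one_apply, Pi.one_apply]

/-- ★★ **(84)∕(87) AT A PURE-GAUGE PERTURBATION**: the accumulated block frame `\overline{R_{0,y}U₁}^{(j)}` ([Balaban1985Averaging] (85), lit `wrec`) of the pure gauge `U₁ = v·R(U₀)v⁻¹`
(lit `mgauge U₀ v 1`) is `v(Lʲy)·(\overline{R₀v⁻¹})ʲ(y)` — lit ✓`eq84_local` at `u := v⁻¹`, whose transformed perturbation `U₁^{u} = 1` trivially satisfies the block axial conditions.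
NO smallness window. [cite: Balaban1985Averaging, (84) p.30, (87) p.31, (55) p.27; Balaban1985BackgroundPropagators, (3.113) p.418] -/
theorem wrec_pureGauge (L : ℕ) (hL : 1 ≤ L) (U₀ : B7Prop1Explicit.Site d → Fin d → 𝔸ˣ) (v : B7Prop1Explicit.Site d → 𝔸ˣ) (j : ℕ) (y : B7Prop1Explicit.Site d) :
    wrec L U₀ (mgauge U₀ v 1) j y = v (((L : ℤ) ^ j) • y) * uavg L U₀ v⁻¹ j y := by
  have h84 := eq84_local L hL U₀ (mgauge U₀ v 1) v⁻¹ j y (fun n _ z _ r => by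
    rw [mgauge_inv_mgauge, tildIter_one_pert, tHol_one_pert])
  rw [h84, uLev_apply, Pi.inv_apply, ← mul_assoc, mul_inv_cancel, one_mul]

/-- ★★ **THE DERIVATIVE OF THE PURE-GAUGE FRAME ALONG `v_t = e^{tλ}`**: `d∕dt|₀ \overline{R_{0,y}(e^{tλ}·R(U₀)e^{−tλ})}^{(j)} = λ(Lʲy) − (Q′_j(U₀)λ)(y)` — §1's product formula, the linear part
`Q′_j` of `R̄ʲ` (lit ✓`hasDerivAt_Rbar` ∘ ✓`rbar_bgT_eq_uavg`) along `e^{−tλ}`, and `d∕dt e^{tλ(Lʲy)} = λ(Lʲy)`.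
[cite: Balaban1985BackgroundPropagators, (3.19) p.393, p.394 (sentence after (3.19)), (3.113) p.418; Balaban1985Averaging, (78)–(80) p.30] -/
theorem hasDerivAt_wrec_expGauge (L : ℕ) (hL : 1 ≤ L) (U₀ : B7Prop1Explicit.Site d → Fin d → 𝔸ˣ) (lam : B7Prop1Explicit.Site d → 𝔸) (j : ℕ) (y : B7Prop1Explicit.Site d) :
    HasDerivAt (fun t : ℂ => ((wrec L U₀ (mgauge U₀ (fun x => expUnit (t • lam x)) 1) j y : 𝔸ˣ) : 𝔸))
      (lam (((L : ℤ) ^ j) • y) - QprimeIter (zdBlocking d L) (bgT L U₀) j lam y) 0 := by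
  -- the product formula, with the inverse transformation `e^{−tλ}` written as `e^{t(−λ)}`
  have hfun : (fun t : ℂ => ((wrec L U₀ (mgauge U₀ (fun x => expUnit (t • lam x)) 1) j y : 𝔸ˣ) : 𝔸))
      = fun t : ℂ => exp (t • lam (((L : ℤ) ^ j) • y)) * Rbar (zdBlocking d L) (bgT L U₀) j (fun x => exp (t • (-lam x))) y := by
    funext t
    rw [wrec_pureGauge L hL, Units.val_mul, val_expUnit]
    congr 1
    have hinv : (fun x => expUnit (t • lam x))⁻¹ = fun x => expUnit (t • (-lam x)) := by
      funext x; rw [Pi.inv_apply, smul_neg]; exact Units.ext (by rw [val_inv_expUnit])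
    rw [hinv]
    have h := congrFun (rbar_bgT_eq_uavg L U₀ (fun x => expUnit (t • (-lam x))) j) y
    simp only [val_expUnit] at h
    exact h.symm
  rw [hfun]
  have h1 : HasDerivAt (fun t : ℂ => exp (t • lam (((L : ℤ) ^ j) • y))) (lam (((L : ℤ) ^ j) • y)) 0 := hasDerivAt_exp_smul_zero _
  have h2 : HasDerivAt (fun t : ℂ => Rbar (zdBlocking d L) (bgT L U₀) j (fun x => exp (t • (-lam x))) y)
      (QprimeIter (zdBlocking d L) (bgT L U₀) j (fun x => -lam x) y) 0 :=
    hasDerivAt_Rbar (zdBlocking d L) (bgT L U₀) (zdBlocking_normalised L (by omega)) (fun x => -lam x) j y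
  have h := h1.mul h2
  -- values at `t = 0`
  have e1 : exp ((0 : ℂ) • lam (((L : ℤ) ^ j) • y)) = (1 : 𝔸) := by rw [zero_smul, exp_zero]
  have e2 : Rbar (zdBlocking d L) (bgT L U₀) j (fun x => exp ((0 : ℂ) • (-lam x))) y = (1 : 𝔸) := by
    have : (fun x => exp ((0 : ℂ) • (-lam x))) = fun _ : B7Prop1Explicit.Site d => (1 : 𝔸) := by funext x; rw [zero_smul, exp_zero]
    rw [this, Rbar_one]
  have hneg : QprimeIter (zdBlocking d L) (bgT L U₀) j (fun x => -lam x) y = -QprimeIter (zdBlocking d L) (bgT L U₀) j lam y := by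
    have h' := congrFun (QprimeIter_smul (zdBlocking d L) (bgT L U₀) (-1 : ℂ) lam j) y
    simp only [neg_one_smul] at h'
    exact h'
  rw [e1, e2, hneg, mul_one, one_mul, ← sub_eq_add_neg] at h
  exact h

end PureGauge

/-! ## §2 The member: `QTw W (D_Wλ) = D̄_{Ū}(Q′_k(W)λ)` for every gauge parameter `λ` -/

section Member

variable (F : T3Family) {n K : ℕ} (h : n ≤ K)

/-- The pull-back of the chart configuration of a gauge transform is the moving-frame pure gauge (55) of the pulled-back transformation:
if `e^{A}·W = W^{v}` bondwise then `(e^{A})♯ = mgauge W♯ v♯ 1`. [cite: Balaban1985Averaging, (8) p.19, (55) p.27] -/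
theorem pull_expUnit_eq_mgauge_of_gaugeActT (W : GaugeField (F.P K) 0 (Matrix.specialUnitaryGroup (Fin 2) ℂ)) (A : PBond (F.P K) 0 → Matrix (Fin 2) (Fin 2) ℂ)
    (v : Site (F.P K) 0 → (Matrix (Fin 2) (Fin 2) ℂ)ˣ) (hcfg : (fun b : PBond (F.P K) 0 => expUnit (A b) * bgUnits F K W b) = gaugeActT v (bgUnits F K W)) :
    pull (fun b : PBond (F.P K) 0 => expUnit (A b)) (basePt F n K) = mgauge (pull (bgUnits F K W) (basePt F n K)) (pullGauge v (basePt F n K)) 1 := by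
  funext z κ
  have hb : expUnit (A ⟨transl (basePt F n K) z, κ⟩) * bgUnits F K W ⟨transl (basePt F n K) z, κ⟩ = gaugeActT v (bgUnits F K W) ⟨transl (basePt F n K) z, κ⟩ :=
    congrFun hcfg ⟨transl (basePt F n K) z, κ⟩
  have hb' : expUnit (A ⟨transl (basePt F n K) z, κ⟩)
      = gaugeActT v (bgUnits F K W) ⟨transl (basePt F n K) z, κ⟩ * (bgUnits F K W ⟨transl (basePt F n K) z, κ⟩)⁻¹ :=
    eq_mul_inv_of_mul_eq hb
  rw [pull_apply, hb', gaugeActT_apply, B7Eq92Concrete.mgauge_apply, B7Eq92Concrete.Rc_apply, pull_apply, pullGauge_apply, pullGauge_apply,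
    B10Eq27TorusAxialLog.transl_add_e]
  simp only [Pi.one_apply, mul_one, mul_inv_rev, inv_inv, mul_assoc]
  rfl

/-- The `k`-centre `x̂ y` of a comparison site is the based translate of `Lᵏ·coordT3 y`: `embIter (K−n) (siteShift y) = transl basePt (Lᵏ • coordT3 y)`.
[cite: Balaban1987RG1, (0.1) p.251; Balaban1985Averaging, (85)–(87) p.31] -/
theorem embIter_siteShift_eq_transl (y : Site (F.P n) 0) :
    embIter (K - n) (siteShift (sites_eq F n K h) y) = transl (basePt F n K) ((((F.P K).L : ℤ) ^ (K - n)) • coordT3 F n K h y) := by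
  have hk : K - n ≤ (F.P K).m + (F.P K).K := by show K - n ≤ F.m + K; omega
  exact embIter_eq_transl hk (siteShift (sites_eq F n K h) y)

/-- ★★★ **THE EXACT INTERTWINING FOR THE TWISTED AVERAGING OF RECORD**: at `W ∈ 𝔘_k(ε₀)` (`RegPr F n K ε₀ W`, windows of ✓`Prop7SymAvgTwOfRegPr.QTw_apply_eq_of_regPr` VERBATIM), for EVERY
gauge parameter `λ : sites → M₂(ℂ)`:  `QTw W (b ↦ λ b₋ − W_b λ b₊ W_b⁻¹) = (c ↦ Q′λ c₋ − Ū(c) Q′λ c₊ Ū(c)⁻¹)` with `Ū = D̄_GL(W♭)` and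
`Q′λ y = (QprimeIter (zdBlocking 3 L) (bgT L W♯) (K−n) λ♯)(coordT3 y)` — print's `Q D λ = D̄ Q′_k λ` ((3.115)) for the route's twisted average, no defect.  Proof: the gauge curve
`A_t = log(e^{tλ(b₋)}W_b e^{−tλ(b₊)}W_b⁻¹)` (`e^{A_t}W♭ = W♭^{e^{tλ}}` near `0`), along which the twisted double-bar average is the coarse pure gauge of `(R̄ᵏ_W e^{−tλ})⁻¹` (§1 + ✓`descendToGL_gaugeActT`);
differentiate (`R̄ᵏ` has linear part `Q′_k`) and compare with the chain rule for `QTw = fderiv (logChartTw W) 0`.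
[cite: Balaban1985BackgroundPropagators, (3.14)–(3.19) p.393, (3.113)–(3.115) p.418; Balaban1985Averaging, (84)–(92) pp.30–31] -/
theorem QTw_gaugeDir_eq_coarseGaugeDir_Qprime {ε₀ : ℝ} (hε₀ : 0 < ε₀) (hε : 10 ^ 7 * (F.L : ℝ) ^ 3 * ε₀ ≤ 1)
    (hα3 : C0 (F.P K).d * (2 * ε₀) ≤ 1 / 3) (hα4 : 4 * (2 * ε₀) ≤ c2' (F.P K).d (F.P K).L)
    (hexp : Real.exp (4 * (800 * (((F.P K).d : ℝ) + 1) ^ 2 * (((F.P K).d : ℝ) + 4)) * (2 * ε₀)) < 2)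
    (W : GaugeField (F.P K) 0 (Matrix.specialUnitaryGroup (Fin 2) ℂ)) (hreg : RegPr F n K ε₀ W)
    (lam : Site (F.P K) 0 → Matrix (Fin 2) (Fin 2) ℂ) :
    QTw F n K h W (fun b : PBond (F.P K) 0 =>
        lam b.src - ((bgUnits F K W b : (Matrix (Fin 2) (Fin 2) ℂ)ˣ) : Matrix (Fin 2) (Fin 2) ℂ) * lam b.tgt
          * (((bgUnits F K W b)⁻¹ : (Matrix (Fin 2) (Fin 2) ℂ)ˣ) : Matrix (Fin 2) (Fin 2) ℂ))
      = fun c : PBond (F.P n) 0 =>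
        QprimeIter (zdBlocking (F.P K).d (F.P K).L) (bgT (F.P K).L (pull (bgUnits F K W) (basePt F n K))) (K - n)
            (fun z => lam (transl (basePt F n K) z)) (coordT3 F n K h c.src)
          - ((descendToGL F n K h (bgUnits F K W) c : (Matrix (Fin 2) (Fin 2) ℂ)ˣ) : Matrix (Fin 2) (Fin 2) ℂ)
              * QprimeIter (zdBlocking (F.P K).d (F.P K).L) (bgT (F.P K).L (pull (bgUnits F K W) (basePt F n K))) (K - n)
                  (fun z => lam (transl (basePt F n K) z)) (coordT3 F n K h c.tgt)
              * (((descendToGL F n K h (bgUnits F K W) c)⁻¹ : (Matrix (Fin 2) (Fin 2) ℂ)ˣ) : Matrix (Fin 2) (Fin 2) ℂ) := by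
  have hL1 : 1 ≤ (F.P K).L := (F.P K).hL.2.le
  -- letters
  set Wp : B7Prop1Explicit.Site (F.P K).d → Fin (F.P K).d → (Matrix (Fin 2) (Fin 2) ℂ)ˣ := pull (bgUnits F K W) (basePt F n K) with hWp
  set lamp : B7Prop1Explicit.Site (F.P K).d → Matrix (Fin 2) (Fin 2) ℂ := fun z => lam (transl (basePt F n K) z) with hlamp
  set Ubar : PBond (F.P n) 0 → (Matrix (Fin 2) (Fin 2) ℂ)ˣ := descendToGL F n K h (bgUnits F K W) with hUbar
  -- the gauge curve and its chart parameter (as in ✓`QTw_gaugeDir_eq_QSym_of_inAx`)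
  set A : ℂ → PBond (F.P K) 0 → Matrix (Fin 2) (Fin 2) ℂ := fun t b =>
    mlog (exp (t • lam b.src) * ((bgUnits F K W b : (Matrix (Fin 2) (Fin 2) ℂ)ˣ) : Matrix (Fin 2) (Fin 2) ℂ) * exp (t • (-lam b.tgt))
      * (((bgUnits F K W b)⁻¹ : (Matrix (Fin 2) (Fin 2) ℂ)ˣ) : Matrix (Fin 2) (Fin 2) ℂ)) with hA
  have hA0 : A 0 = 0 := by
    funext b
    show mlog (exp ((0 : ℂ) • lam b.src) * _ * exp ((0 : ℂ) • (-lam b.tgt)) * _) = 0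
    rw [conjCurve_zero, Units.mul_inv, mlog_one]
  have hA' : HasDerivAt A (fun b : PBond (F.P K) 0 =>
      lam b.src - ((bgUnits F K W b : (Matrix (Fin 2) (Fin 2) ℂ)ˣ) : Matrix (Fin 2) (Fin 2) ℂ) * lam b.tgt
        * (((bgUnits F K W b)⁻¹ : (Matrix (Fin 2) (Fin 2) ℂ)ˣ) : Matrix (Fin 2) (Fin 2) ℂ)) 0 := by
    rw [hasDerivAt_pi]
    intro b
    exact hasDerivAt_mlog_conjCurve (lam b.src) (lam b.tgt) (bgUnits F K W b)
  -- the chain rule for `QTw = fderiv (logChartTw W) 0`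
  have hT : HasFDerivAt (logChartTw F n K h W) (QTw F n K h W) (A 0) := by
    rw [hA0, QTw_def]
    exact (hasFDerivAt_logChartTw F h W (hasFDerivAt_rel_of_regPr F h hε₀ hε W hreg) (hasFDerivAt_frameTw_of_regPr F h hε₀ hα3 hα4 hexp W hreg)).differentiableAt.hasFDerivAt
  have hTc := hT.comp_hasDerivAt (0 : ℂ) hA'
  -- the averaged inverse transformation `g_t(y) = (R̄ᵏ_{W♯} e^{−tλ♯})(coordT3 y)` and its derivative `−Q′λ`
  have hg : ∀ y : Site (F.P n) 0, HasDerivAt (fun t : ℂ =>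
      ((uavg (F.P K).L Wp (pullGauge (fun x => expUnit (t • lam x)) (basePt F n K))⁻¹ (K - n) (coordT3 F n K h y) : (Matrix (Fin 2) (Fin 2) ℂ)ˣ) : Matrix (Fin 2) (Fin 2) ℂ))
      (-QprimeIter (zdBlocking (F.P K).d (F.P K).L) (bgT (F.P K).L Wp) (K - n) lamp (coordT3 F n K h y)) 0 := by
    intro y
    have hfun : (fun t : ℂ => ((uavg (F.P K).L Wp (pullGauge (fun x => expUnit (t • lam x)) (basePt F n K))⁻¹ (K - n) (coordT3 F n K h y) : (Matrix (Fin 2) (Fin 2) ℂ)ˣ) :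
          Matrix (Fin 2) (Fin 2) ℂ))
        = fun t : ℂ => Rbar (zdBlocking (F.P K).d (F.P K).L) (bgT (F.P K).L Wp) (K - n) (fun x => exp (t • (-lamp x))) (coordT3 F n K h y) := by
      funext t
      have hinv : (pullGauge (fun x => expUnit (t • lam x)) (basePt F n K))⁻¹ = fun x => expUnit (t • (-lamp x)) := by
        funext x; rw [Pi.inv_apply, pullGauge_apply, smul_neg]; exact Units.ext (by rw [val_inv_expUnit])
      rw [hinv]
      have h' := congrFun (rbar_bgT_eq_uavg (F.P K).L Wp (fun x => expUnit (t • (-lamp x))) (K - n)) (coordT3 F n K h y)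
      simp only [val_expUnit] at h'
      exact h'.symm
    rw [hfun]
    have h2 := hasDerivAt_Rbar (zdBlocking (F.P K).d (F.P K).L) (bgT (F.P K).L Wp) (zdBlocking_normalised (F.P K).L (by omega)) (fun x => -lamp x) (K - n)
      (coordT3 F n K h y)
    have hneg : QprimeIter (zdBlocking (F.P K).d (F.P K).L) (bgT (F.P K).L Wp) (K - n) (fun x => -lamp x) (coordT3 F n K h y)
        = -QprimeIter (zdBlocking (F.P K).d (F.P K).L) (bgT (F.P K).L Wp) (K - n) lamp (coordT3 F n K h y) := by
      have h' := congrFun (QprimeIter_smul (zdBlocking (F.P K).d (F.P K).L) (bgT (F.P K).L Wp) (-1 : ℂ) lamp (K - n)) (coordT3 F n K h y)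
      simp only [neg_one_smul] at h'
      exact h'
    rw [← hneg]
    exact h2
  have hg0 : ∀ y : Site (F.P n) 0,
      ((uavg (F.P K).L Wp (pullGauge (fun x => expUnit ((0 : ℂ) • lam x)) (basePt F n K))⁻¹ (K - n) (coordT3 F n K h y) : (Matrix (Fin 2) (Fin 2) ℂ)ˣ) : Matrix (Fin 2) (Fin 2) ℂ)
        = 1 := by
    intro y
    have hone : (pullGauge (fun x => expUnit ((0 : ℂ) • lam x)) (basePt F n K))⁻¹ = fun _ => (1 : (Matrix (Fin 2) (Fin 2) ℂ)ˣ) := by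
      funext x; rw [Pi.inv_apply, pullGauge_apply, zero_smul]; exact Units.ext (by rw [val_inv_expUnit, neg_zero, val_expUnit, exp_zero, Units.val_one])
    rw [hone]
    have h' := congrFun (rbar_bgT_eq_uavg (F.P K).L Wp (fun _ => (1 : (Matrix (Fin 2) (Fin 2) ℂ)ˣ)) (K - n)) (coordT3 F n K h y)
    simp only [Units.val_one] at h'
    rw [← h', Rbar_one]
  -- the explicit coarse curve `G_t(c) = g_t(c₋)⁻¹·Ū(c)·g_t(c₊)·Ū(c)⁻¹` and its derivative
  set g : ℂ → Site (F.P n) 0 → (Matrix (Fin 2) (Fin 2) ℂ)ˣ := fun t y =>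
    uavg (F.P K).L Wp (pullGauge (fun x => expUnit (t • lam x)) (basePt F n K))⁻¹ (K - n) (coordT3 F n K h y) with hgdef
  have hG : ∀ c : PBond (F.P n) 0, HasDerivAt (fun t : ℂ =>
      mlog ((((g t c.src)⁻¹ * Ubar c * g t c.tgt * (Ubar c)⁻¹ : (Matrix (Fin 2) (Fin 2) ℂ)ˣ)) : Matrix (Fin 2) (Fin 2) ℂ))
      (QprimeIter (zdBlocking (F.P K).d (F.P K).L) (bgT (F.P K).L Wp) (K - n) lamp (coordT3 F n K h c.src)
        - (Ubar c : Matrix (Fin 2) (Fin 2) ℂ) * QprimeIter (zdBlocking (F.P K).d (F.P K).L) (bgT (F.P K).L Wp) (K - n) lamp (coordT3 F n K h c.tgt)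
          * (((Ubar c)⁻¹ : (Matrix (Fin 2) (Fin 2) ℂ)ˣ) : Matrix (Fin 2) (Fin 2) ℂ)) 0 := by
    intro c
    have h1 : HasDerivAt (fun t : ℂ => Ring.inverse ((g t c.src : (Matrix (Fin 2) (Fin 2) ℂ)ˣ) : Matrix (Fin 2) (Fin 2) ℂ))
        (-(-QprimeIter (zdBlocking (F.P K).d (F.P K).L) (bgT (F.P K).L Wp) (K - n) lamp (coordT3 F n K h c.src))) 0 :=
      hasDerivAt_inverse_comp_one (hg0 c.src) (hg c.src)
    have h2 := hg c.tgt
    have h3 : HasDerivAt (fun _ : ℂ => (Ubar c : Matrix (Fin 2) (Fin 2) ℂ)) 0 0 := hasDerivAt_const _ _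
    have h4 : HasDerivAt (fun _ : ℂ => (((Ubar c)⁻¹ : (Matrix (Fin 2) (Fin 2) ℂ)ˣ) : Matrix (Fin 2) (Fin 2) ℂ)) 0 0 := hasDerivAt_const _ _
    have h1234 := ((h1.mul h3).mul h2).mul h4
    have hfun : (fun t : ℂ => (((g t c.src)⁻¹ * Ubar c * g t c.tgt * (Ubar c)⁻¹ : (Matrix (Fin 2) (Fin 2) ℂ)ˣ) : Matrix (Fin 2) (Fin 2) ℂ))
        = fun t : ℂ => Ring.inverse ((g t c.src : (Matrix (Fin 2) (Fin 2) ℂ)ˣ) : Matrix (Fin 2) (Fin 2) ℂ) * (Ubar c : Matrix (Fin 2) (Fin 2) ℂ)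
            * ((g t c.tgt : (Matrix (Fin 2) (Fin 2) ℂ)ˣ) : Matrix (Fin 2) (Fin 2) ℂ) * (((Ubar c)⁻¹ : (Matrix (Fin 2) (Fin 2) ℂ)ˣ) : Matrix (Fin 2) (Fin 2) ℂ) := by
      funext t; rw [Units.val_mul, Units.val_mul, Units.val_mul, Ring.inverse_unit]
    have h0 : (((g 0 c.src)⁻¹ * Ubar c * g 0 c.tgt * (Ubar c)⁻¹ : (Matrix (Fin 2) (Fin 2) ℂ)ˣ) : Matrix (Fin 2) (Fin 2) ℂ) = 1 := by
      have hs : g 0 c.src = 1 := Units.ext (hg0 c.src)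
      have ht : g 0 c.tgt = 1 := Units.ext (hg0 c.tgt)
      rw [hs, ht, inv_one, one_mul, mul_one, mul_inv_cancel, Units.val_one]
    refine hasDerivAt_mlog_comp h0 ?_
    rw [hfun]
    refine h1234.congr_deriv ?_
    have hu : (Ubar c : Matrix (Fin 2) (Fin 2) ℂ) * (((Ubar c)⁻¹ : (Matrix (Fin 2) (Fin 2) ℂ)ˣ) : Matrix (Fin 2) (Fin 2) ℂ) = 1 := Units.mul_inv _
    have hg0' : ∀ y : Site (F.P n) 0, ((g 0 y : (Matrix (Fin 2) (Fin 2) ℂ)ˣ) : Matrix (Fin 2) (Fin 2) ℂ) = 1 := hg0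
    simp only [Pi.mul_apply, hg0, hg0', Ring.inverse_one, neg_neg, mul_zero, add_zero, mul_one, one_mul]
    rw [add_mul, mul_assoc _ (Ubar c : Matrix (Fin 2) (Fin 2) ℂ), hu, mul_one, mul_neg, neg_mul, ← sub_eq_add_neg, mul_assoc]
  have hGpi : HasDerivAt (fun t : ℂ => fun c : PBond (F.P n) 0 =>
      mlog ((((g t c.src)⁻¹ * Ubar c * g t c.tgt * (Ubar c)⁻¹ : (Matrix (Fin 2) (Fin 2) ℂ)ˣ)) : Matrix (Fin 2) (Fin 2) ℂ))
      (fun c : PBond (F.P n) 0 =>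
        QprimeIter (zdBlocking (F.P K).d (F.P K).L) (bgT (F.P K).L Wp) (K - n) lamp (coordT3 F n K h c.src)
          - (Ubar c : Matrix (Fin 2) (Fin 2) ℂ) * QprimeIter (zdBlocking (F.P K).d (F.P K).L) (bgT (F.P K).L Wp) (K - n) lamp (coordT3 F n K h c.tgt)
            * (((Ubar c)⁻¹ : (Matrix (Fin 2) (Fin 2) ℂ)ˣ) : Matrix (Fin 2) (Fin 2) ℂ)) 0 := by
    rw [hasDerivAt_pi]; exact hG
  -- along the curve, the twisted double-bar average IS that coarse pure gauge (for `t` near `0`)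
  have hev : (logChartTw F n K h W ∘ A) =ᶠ[𝓝 0] (fun t : ℂ => fun c : PBond (F.P n) 0 =>
      mlog ((((g t c.src)⁻¹ * Ubar c * g t c.tgt * (Ubar c)⁻¹ : (Matrix (Fin 2) (Fin 2) ℂ)ˣ)) : Matrix (Fin 2) (Fin 2) ℂ)) := by
    filter_upwards [expUnit_chartCurve_eventually (F := F) W lam] with t ht
    funext c
    show logChartTw F n K h W (A t) c = _
    have hcfg : (fun b => expUnit (A t b) * bgUnits F K W b) = gaugeActT (fun x => expUnit (t • lam x)) (bgUnits F K W) := ht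
    -- the frames of the pure-gauge perturbation, by §1
    have hfr : ∀ y : Site (F.P n) 0, frameTw F n K h W (A t) y
        = expUnit (t • lam (embIter (K - n) (siteShift (sites_eq F n K h) y))) * g t y := by
      intro y
      rw [frameTw_def, pull_expUnit_eq_mgauge_of_gaugeActT F W (A t) _ hcfg, wrec_pureGauge _ hL1, pullGauge_apply, ← embIter_siteShift_eq_transl F h]
      rfl
    rw [logChartTw_apply, dbarTw_def, hfr c.src, hfr c.tgt, hcfg, descendToGL_gaugeActT, transfUp_eq_embIter, transfUp_eq_embIter]
    show mlog ((( _ : (Matrix (Fin 2) (Fin 2) ℂ)ˣ)) : Matrix (Fin 2) (Fin 2) ℂ) = mlog ((((g t c.src)⁻¹ * Ubar c * g t c.tgt * (Ubar c)⁻¹ : (Matrix (Fin 2) (Fin 2) ℂ)ˣ)) : Matrix (Fin 2) (Fin 2) ℂ)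
    congr 2
    rw [hUbar]
    group
  exact hTc.unique (hGpi.congr_of_eventuallyEq hev)

end Member

end Summit.QuantumFields.YangMills.Theorems.Prop7TwistedIntertwining

end
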